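import Literature.AlgebraicGeometry.HodgeTheory.GysinKernelSplitHolds
import Literature.AlgebraicGeometry.HodgeTheory.SupportedClassesHodgeConiveauOfDeligne
import HarnessLib

/-!
# Grothendieck's coniveau fact holds

Topic `Literature/AlgebraicGeometry/HodgeTheory`; proofs-only file (no definitions, no new named
facts). The named fact `Grothendieck1969_supportedClasses_le_hodgeConiveau`
(`SupportedClassesHodgeConiveau.lean`; Grothendieck 1969, p. 299 (∗) and p. 300; Voisin 2014,
Thm. 2.39: classes supported in codimension `≥ s` have Hodge coniveau `≥ s`) is closed by ONE TERM
from results already in the tree: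

* the accepted reduction `Grothendieck1969_supportedClasses_le_hodgeConiveau_of_deligne'`
  (`SupportedClassesHodgeConiveauOfDeligne.lean`: the fact granted Deligne, *Hodge III*, Cor. 8.2.8
  alone — Hodge models and de Rham's theorem with products being discharged in the tree);
* Deligne's Cor. 8.2.8, `Deligne1974_ker_restrictCompl_eq_iSup_range_complexGysin`, obtained from
  its proved child Prop. 8.2.7 (`Deligne1974_ker_pullback_eq_ker_pullback_resolution_holds`,
  `GysinKernelSplitHolds.lean`) through the split
  `Deligne1974_ker_restrictCompl_eq_iSup_range_complexGysin_holds_of` (`GysinKernelSplit.lean`).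

The same Cor. 8.2.8 discharge is also recorded as
`Deligne1974_ker_restrictCompl_eq_iSup_range_complexGysin_holds` in `SaitoGrFDeRhamCurveNetHolds.lean`;
it is re-derived inline here so that this file does not depend on the Saito de Rham package (whose
import closure, until the 2026-08-16 rename in
`Barriers/HodgeConjecture/GeneralizedHodgeTrivialReasonsSubHodgeProofs` has propagated, could not
be combined with that of `SupportedClassesHodgeConiveauOfDeligne`). Found by the librarian's
forward-chaining census (sweep g29, 2026-08-16): the reduction and the last of its inputs landed in
different units, so nobody had written the closing line; the fact is named in ≈ 90 files.
-/

namespace Literature.AlgebraicGeometry.HodgeTheory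

/-- **Grothendieck 1969 (∗)/p. 300, Voisin 2014 Thm. 2.39 — holds**: for a smooth projective
complex variety, the complex span of the rational classes supported in codimension `≥ s` lies in
the Hodge coniveau-`s` part `⨆_{p+q=k, p ≥ s, q ≥ s} H^{p,q}`. One term: the Deligne-only
reduction applied to Deligne's Cor. 8.2.8, itself from the proved Prop. 8.2.7.
[cite: GrothendieckTopology1969, p. 299 (∗) and p. 300]
[cite: DeligneHodgeIII1974, Prop. 8.2.7 and Cor. 8.2.8 (p. 40)] -/
theorem Grothendieck1969_supportedClasses_le_hodgeConiveau_holds :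
    Grothendieck1969_supportedClasses_le_hodgeConiveau :=
  Grothendieck1969_supportedClasses_le_hodgeConiveau_of_deligne'
    (Deligne1974_ker_restrictCompl_eq_iSup_range_complexGysin_holds_of
      Deligne1974_ker_pullback_eq_ker_pullback_resolution_holds)

end Literature.AlgebraicGeometry.HodgeTheory
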